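import Summits.CriticalPhenomena.PercolationContinuityZ3.Theorems.PercNearOneGluingNoHeavyLowerTailStarSetMixedLonely
import HarnessLib

/-!
# `NoHeavyLowerTail` (stmt-CriticalPhenomena-4575) — the MIXED (forest + chords) certificate, pointwise

Support file (prover `prim-gen-swap` gen 9; `--supports stmt-CriticalPhenomena-4575`).  No definitions, no named facts, no sorries.

Seat memo MWF-CERT.md §3–§4.  Classes `Fin (Mf + Mc)` of a two-port star multigraph off an observer `c ∈ A`: the first `Mf` form a
class forest in leaf-peeling order (`hforest`) and carry CHAMPION rows `1[c light in ξ ∪ L_S] − 1[P_I light in ξ ∪ L_S]` with nested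
coefficients `c_I = Θ_I Π_{K<I}(1 − Θ_K)`; the last `Mc` ("chords") carry relay-PAIR rows `CS({P_K, P'_K}; c)` with multipliers
`D_K = Θ_K Π_{K' far from K}(1 − Θ_{K'})`.  Budget cells `t : ι` (`b_t ≥ 0`, designated port sets `R_t`).  Pointwise off the stars,
`C0·(rows) ≤ C0·CS(P_S; c) + Σ_t b_t 1[B_t(S)]` against the pattern weights, GIVEN the supplies `hU0 : C0(Σ_I c_I + Σ_K D_K) ≤ C0 + Σ_t b_t`
and `hU1 r : C0(Σ_{I : P_I ≠ r} c_I + Σ_{K : r ∉ R_K} D_K) ≤ C0 + Σ_{t : r ∉ R_t} b_t`.  Proof: `StarSet.classes_c_trichotomy`; the lonely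
word is paid by `StarSet.mixed_lonely_le` (dead set `∅` in cases (i),(ii), `{r}` in case (iii), witness `c`); in case (iii) the champion
rows of the classes with `P_I = r` are refunded exactly (`P_I` light iff `c` light) — the `x_r` credit of MWF-CERT.md §3.

* `StarSet.mixed_certificate_pointwise`.
-/

noncomputable section

namespace Summit.CriticalPhenomena.PercolationContinuityZ3.Theorems

open MeasureTheory Set Literature.Probability.LatticeModels Literature.Probability.Percolation
open scoped Classical BigOperators

variable {n Mf Mc : ℕ}

namespace StarSet

/-- **The mixed (forest + chords) certificate, pointwise.**  See the file header.  Classes `Fin (Mf + Mc)`: forest classes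
`Fin.castAdd Mc I` (leaf-peeling order, champion rows `G − Sp_I` with nested coefficients `c_I = Θ_I Π_{K<I}(1 − Θ_K)`), chord classes
`Fin.natAdd Mf K` (relay-pair rows with multipliers `D_K = Θ_K·Zfar_K`); budget cells `t : ι` with `b_t ≥ 0` and designated port sets
`R_t`; supplies `hU0`, `hU1`. [MWF-CERT.md §3–§4] -/
theorem mixed_certificate_pointwise {ι : Type*} [Fintype ι] (w : Sym2 (Fin n) → unitInterval) (A : Finset (Fin n)) {m : ℕ}
    (s p p' : Fin m → Fin n) (cls : Fin m → Fin (Mf + Mc)) (P P' : Fin (Mf + Mc) → Fin n)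
    (c : Fin n) (j : ℕ) (hj : j ≤ 2)
    (hPA : ∀ κ, P κ ∈ A) (hP'A : ∀ κ, P' κ ∈ A) (hPP' : ∀ κ, P κ ≠ P' κ)
    (hnopar : ∀ I K : Fin (Mf + Mc), I ≠ K → ¬ ((P K = P I ∨ P K = P' I) ∧ (P' K = P I ∨ P' K = P' I)))
    (hforest : ∀ K I : Fin Mf, K < I → P' (Fin.castAdd Mc K) ≠ P (Fin.castAdd Mc I) ∧ P' (Fin.castAdd Mc K) ≠ P' (Fin.castAdd Mc I))
    (hcA : c ∈ A) (hcP : ∀ κ, c ≠ P κ ∧ c ≠ P' κ)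
    (C0 : ℝ) (hC0 : 0 ≤ C0) (b : ι → ℝ) (hb : ∀ t, 0 ≤ b t) (R : ι → Finset (Fin n))
    (hRport : ∀ t, ∀ u ∈ R t, ∃ κ, u = P κ ∨ u = P' κ)
    (hU0 : C0 * (∑ I : Fin Mf, ((1 - ∏ i ∈ Finset.univ.filter (fun i => cls i = Fin.castAdd Mc I), (1 - (w s(s i, p i) : ℝ) * w s(s i, p' i))) *
          ∏ K ∈ Finset.univ.filter (· < I), ∏ i ∈ Finset.univ.filter (fun i => cls i = Fin.castAdd Mc K), (1 - (w s(s i, p i) : ℝ) * w s(s i, p' i))) +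
        ∑ K : Fin Mc, ((1 - ∏ i ∈ Finset.univ.filter (fun i => cls i = Fin.natAdd Mf K), (1 - (w s(s i, p i) : ℝ) * w s(s i, p' i))) *
          ∏ κ' ∈ Finset.univ.filter (fun κ' => ¬ (P κ' = P (Fin.natAdd Mf K) ∨ P κ' = P' (Fin.natAdd Mf K) ∨
              P' κ' = P (Fin.natAdd Mf K) ∨ P' κ' = P' (Fin.natAdd Mf K))),
            ∏ i ∈ Finset.univ.filter (fun i => cls i = κ'), (1 - (w s(s i, p i) : ℝ) * w s(s i, p' i)))) ≤ C0 + ∑ t, b t)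
    (hU1 : ∀ r, C0 * (∑ I ∈ (Finset.univ : Finset (Fin Mf)).filter (fun I => P (Fin.castAdd Mc I) ≠ r), ((1 - ∏ i ∈ Finset.univ.filter (fun i => cls i = Fin.castAdd Mc I), (1 - (w s(s i, p i) : ℝ) * w s(s i, p' i))) *
          ∏ K ∈ Finset.univ.filter (· < I), ∏ i ∈ Finset.univ.filter (fun i => cls i = Fin.castAdd Mc K), (1 - (w s(s i, p i) : ℝ) * w s(s i, p' i))) +
        ∑ K ∈ (Finset.univ : Finset (Fin Mc)).filter (fun K => P (Fin.natAdd Mf K) ≠ r ∧ P' (Fin.natAdd Mf K) ≠ r), ((1 - ∏ i ∈ Finset.univ.filter (fun i => cls i = Fin.natAdd Mf K), (1 - (w s(s i, p i) : ℝ) * w s(s i, p' i))) *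
          ∏ κ' ∈ Finset.univ.filter (fun κ' => ¬ (P κ' = P (Fin.natAdd Mf K) ∨ P κ' = P' (Fin.natAdd Mf K) ∨
              P' κ' = P (Fin.natAdd Mf K) ∨ P' κ' = P' (Fin.natAdd Mf K))),
            ∏ i ∈ Finset.univ.filter (fun i => cls i = κ'), (1 - (w s(s i, p i) : ℝ) * w s(s i, p' i)))) ≤
        C0 + ∑ t ∈ Finset.univ.filter (fun t => r ∉ R t), b t)
    (ω : BondConfig (Fin n)) :
    C0 * (∑ I : Fin Mf, ((1 - ∏ i ∈ Finset.univ.filter (fun i => cls i = Fin.castAdd Mc I), (1 - (w s(s i, p i) : ℝ) * w s(s i, p' i))) *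
          ∏ K ∈ Finset.univ.filter (· < I), ∏ i ∈ Finset.univ.filter (fun i => cls i = Fin.castAdd Mc K), (1 - (w s(s i, p i) : ℝ) * w s(s i, p' i))) *
        ∑ S ∈ (Finset.univ : Finset (Fin (Mf + Mc))).powerset, ((∏ κ ∈ S, (1 - ∏ i ∈ Finset.univ.filter (fun i => cls i = κ), (1 - (w s(s i, p i) : ℝ) * w s(s i, p' i)))) *
          ∏ κ ∈ Finset.univ \ S, ∏ i ∈ Finset.univ.filter (fun i => cls i = κ), (1 - (w s(s i, p i) : ℝ) * w s(s i, p' i))) *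
          (DecisionTree.ind {ω' : BondConfig (Fin n) |
            (A.filter fun z => (openGraph ((ω' ∩ {e | ∀ v ∈ Finset.univ.image s, v ∉ e}) ∪
              ↑(S.image fun κ => (s(P κ, P' κ) : Sym2 (Fin n))))).Reachable c z).card ≤ j} ω -
          DecisionTree.ind {ω' : BondConfig (Fin n) |
            (A.filter fun z => (openGraph ((ω' ∩ {e | ∀ v ∈ Finset.univ.image s, v ∉ e}) ∪
              ↑(S.image fun κ => (s(P κ, P' κ) : Sym2 (Fin n))))).Reachable (P (Fin.castAdd Mc I)) z).card ≤ j} ω) +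
      ∑ K : Fin Mc, ((1 - ∏ i ∈ Finset.univ.filter (fun i => cls i = Fin.natAdd Mf K), (1 - (w s(s i, p i) : ℝ) * w s(s i, p' i))) *
          ∏ κ' ∈ Finset.univ.filter (fun κ' => ¬ (P κ' = P (Fin.natAdd Mf K) ∨ P κ' = P' (Fin.natAdd Mf K) ∨
              P' κ' = P (Fin.natAdd Mf K) ∨ P' κ' = P' (Fin.natAdd Mf K))),
            ∏ i ∈ Finset.univ.filter (fun i => cls i = κ'), (1 - (w s(s i, p i) : ℝ) * w s(s i, p' i))) *
        ∑ S ∈ (Finset.univ : Finset (Fin (Mf + Mc))).powerset, ((∏ κ ∈ S, (1 - ∏ i ∈ Finset.univ.filter (fun i => cls i = κ), (1 - (w s(s i, p i) : ℝ) * w s(s i, p' i)))) *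
          ∏ κ ∈ Finset.univ \ S, ∏ i ∈ Finset.univ.filter (fun i => cls i = κ), (1 - (w s(s i, p i) : ℝ) * w s(s i, p' i))) *
          (DecisionTree.ind {ω' : BondConfig (Fin n) |
            (∀ u ∈ ({Fin.natAdd Mf K} : Finset (Fin (Mf + Mc))).image P ∪ ({Fin.natAdd Mf K} : Finset (Fin (Mf + Mc))).image P',
              ¬ (openGraph ((ω' ∩ {e | ∀ v ∈ Finset.univ.image s, v ∉ e}) ∪
                ↑(S.image fun κ => (s(P κ, P' κ) : Sym2 (Fin n))))).Reachable c u) ∧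
            (A.filter fun z => (openGraph ((ω' ∩ {e | ∀ v ∈ Finset.univ.image s, v ∉ e}) ∪
              ↑(S.image fun κ => (s(P κ, P' κ) : Sym2 (Fin n))))).Reachable c z).card ≤ j} ω -
          DecisionTree.ind {ω' : BondConfig (Fin n) |
            (∀ u ∈ ({Fin.natAdd Mf K} : Finset (Fin (Mf + Mc))).image P ∪ ({Fin.natAdd Mf K} : Finset (Fin (Mf + Mc))).image P',
              ¬ (openGraph ((ω' ∩ {e | ∀ v ∈ Finset.univ.image s, v ∉ e}) ∪
                ↑(S.image fun κ => (s(P κ, P' κ) : Sym2 (Fin n))))).Reachable c u) ∧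
            1 ≤ (A.filter fun z => ∃ u ∈ ({Fin.natAdd Mf K} : Finset (Fin (Mf + Mc))).image P ∪ ({Fin.natAdd Mf K} : Finset (Fin (Mf + Mc))).image P',
              (openGraph ((ω' ∩ {e | ∀ v ∈ Finset.univ.image s, v ∉ e}) ∪
                ↑(S.image fun κ => (s(P κ, P' κ) : Sym2 (Fin n))))).Reachable u z).card ∧
            (A.filter fun z => ∃ u ∈ ({Fin.natAdd Mf K} : Finset (Fin (Mf + Mc))).image P ∪ ({Fin.natAdd Mf K} : Finset (Fin (Mf + Mc))).image P',
              (openGraph ((ω' ∩ {e | ∀ v ∈ Finset.univ.image s, v ∉ e}) ∪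
                ↑(S.image fun κ => (s(P κ, P' κ) : Sym2 (Fin n))))).Reachable u z).card ≤ j} ω)) ≤
    C0 * ∑ S ∈ (Finset.univ : Finset (Fin (Mf + Mc))).powerset, ((∏ κ ∈ S, (1 - ∏ i ∈ Finset.univ.filter (fun i => cls i = κ), (1 - (w s(s i, p i) : ℝ) * w s(s i, p' i)))) *
          ∏ κ ∈ Finset.univ \ S, ∏ i ∈ Finset.univ.filter (fun i => cls i = κ), (1 - (w s(s i, p i) : ℝ) * w s(s i, p' i))) *
        (DecisionTree.ind {ω' : BondConfig (Fin n) |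
            (∀ u ∈ S.image P ∪ S.image P', ¬ (openGraph (ω' ∩ {e | ∀ v ∈ Finset.univ.image s, v ∉ e})).Reachable c u) ∧
            (A.filter fun z => (openGraph (ω' ∩ {e | ∀ v ∈ Finset.univ.image s, v ∉ e})).Reachable c z).card ≤ j} ω -
          DecisionTree.ind {ω' : BondConfig (Fin n) |
            (∀ u ∈ S.image P ∪ S.image P', ¬ (openGraph (ω' ∩ {e | ∀ v ∈ Finset.univ.image s, v ∉ e})).Reachable c u) ∧
            1 ≤ (A.filter fun z => ∃ u ∈ S.image P ∪ S.image P',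
              (openGraph (ω' ∩ {e | ∀ v ∈ Finset.univ.image s, v ∉ e})).Reachable u z).card ∧
            (A.filter fun z => ∃ u ∈ S.image P ∪ S.image P',
              (openGraph (ω' ∩ {e | ∀ v ∈ Finset.univ.image s, v ∉ e})).Reachable u z).card ≤ j} ω) +
      ∑ t, b t * ∑ S ∈ (Finset.univ : Finset (Fin (Mf + Mc))).powerset, ((∏ κ ∈ S, (1 - ∏ i ∈ Finset.univ.filter (fun i => cls i = κ), (1 - (w s(s i, p i) : ℝ) * w s(s i, p' i)))) *
          ∏ κ ∈ Finset.univ \ S, ∏ i ∈ Finset.univ.filter (fun i => cls i = κ), (1 - (w s(s i, p i) : ℝ) * w s(s i, p' i))) *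
        DecisionTree.ind {ω' : BondConfig (Fin n) |
            (∀ u ∈ R t ∪ (S.image P ∪ S.image P'), ¬ (openGraph (ω' ∩ {e | ∀ v ∈ Finset.univ.image s, v ∉ e})).Reachable c u) ∧
            (A.filter fun z => (openGraph (ω' ∩ {e | ∀ v ∈ Finset.univ.image s, v ∉ e})).Reachable c z).card ≤ j} ω := by
  -- abbreviations
  set θ : Fin m → ℝ := fun i => (w s(s i, p i) : ℝ) * w s(s i, p' i) with hθ
  have hθ1 : ∀ i, θ i ≤ 1 := fun i => mul_le_one₀ (w _).2.2 (w _).2.1 (w _).2.2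
  set uu : Fin (Mf + Mc) → ℝ := fun κ => ∏ i ∈ Finset.univ.filter (fun i => cls i = κ), (1 - θ i) with huu
  have huu0 : ∀ κ, 0 ≤ uu κ := fun κ => Finset.prod_nonneg fun i _ => sub_nonneg.2 (hθ1 i)
  have huu1 : ∀ κ, uu κ ≤ 1 := fun κ =>
    Finset.prod_le_one (fun i _ => sub_nonneg.2 (hθ1 i)) fun i _ => sub_le_self _ (mul_nonneg (w _).2.1 (w _).2.1)
  set Θ : Fin (Mf + Mc) → ℝ := fun κ => 1 - uu κ with hΘ
  have hΘ0 : ∀ κ, 0 ≤ Θ κ := fun κ => sub_nonneg.2 (huu1 κ)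
  have hΘuu : ∀ κ, 1 - Θ κ = uu κ := fun κ => by simp only [hΘ, sub_sub_cancel]
  set W : Finset (Fin (Mf + Mc)) → ℝ := fun S => (∏ κ ∈ S, Θ κ) * ∏ κ ∈ Finset.univ \ S, uu κ with hW
  have hWnn : ∀ S, 0 ≤ W S := fun S => mul_nonneg (Finset.prod_nonneg fun κ _ => hΘ0 κ) (Finset.prod_nonneg fun κ _ => huu0 κ)
  set touch : Fin (Mf + Mc) → Fin (Mf + Mc) → Prop := fun K' K => P K' = P K ∨ P K' = P' K ∨ P' K' = P K ∨ P' K' = P' K with htouch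
  set D : Fin Mc → ℝ := fun K => Θ (Fin.natAdd Mf K) * ∏ κ' ∈ Finset.univ.filter (fun κ' => ¬ touch κ' (Fin.natAdd Mf K)), uu κ' with hD
  have hDnn : ∀ K, 0 ≤ D K := fun K => mul_nonneg (hΘ0 _) (Finset.prod_nonneg fun κ' _ => huu0 κ')
  set cfF : Fin Mf → ℝ := fun I => Θ (Fin.castAdd Mc I) * ∏ K ∈ Finset.univ.filter (· < I), uu (Fin.castAdd Mc K) with hcfF
  have hcfFnn : ∀ I, 0 ≤ cfF I := fun I => mul_nonneg (hΘ0 _) (Finset.prod_nonneg fun K _ => huu0 _)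
  have hsumW : ∑ S ∈ (Finset.univ : Finset (Fin (Mf + Mc))).powerset, W S = 1 := by
    have h := cylinder_sum_closed Θ (∅ : Finset (Fin (Mf + Mc)))
    simp only [hΘuu, Finset.notMem_empty, IsEmpty.forall_iff, implies_true, if_true, mul_one, Finset.prod_empty] at h
    exact h
  set ξ : BondConfig (Fin n) := ω ∩ {e | ∀ v ∈ Finset.univ.image s, v ∉ e} with hξ
  set L : Finset (Fin (Mf + Mc)) → Set (Sym2 (Fin n)) := fun S => ↑(S.image fun κ => (s(P κ, P' κ) : Sym2 (Fin n))) with hL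
  set RK : Fin (Mf + Mc) → Finset (Fin n) := fun κ => ({κ} : Finset (Fin (Mf + Mc))).image P ∪ ({κ} : Finset (Fin (Mf + Mc))).image P'
    with hRK
  set ρ : Fin Mc → Finset (Fin (Mf + Mc)) → Set (BondConfig (Fin n)) := fun K S => {ω' |
    (∀ u ∈ RK (Fin.natAdd Mf K), ¬ (openGraph ((ω' ∩ {e | ∀ v ∈ Finset.univ.image s, v ∉ e}) ∪
      ↑(S.image fun κ => (s(P κ, P' κ) : Sym2 (Fin n))))).Reachable c u) ∧
    (A.filter fun z => (openGraph ((ω' ∩ {e | ∀ v ∈ Finset.univ.image s, v ∉ e}) ∪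
      ↑(S.image fun κ => (s(P κ, P' κ) : Sym2 (Fin n))))).Reachable c z).card ≤ j} with hρ
  set ℓ : Fin Mc → Finset (Fin (Mf + Mc)) → Set (BondConfig (Fin n)) := fun K S => {ω' |
    (∀ u ∈ RK (Fin.natAdd Mf K), ¬ (openGraph ((ω' ∩ {e | ∀ v ∈ Finset.univ.image s, v ∉ e}) ∪
      ↑(S.image fun κ => (s(P κ, P' κ) : Sym2 (Fin n))))).Reachable c u) ∧
    1 ≤ (A.filter fun z => ∃ u ∈ RK (Fin.natAdd Mf K),
      (openGraph ((ω' ∩ {e | ∀ v ∈ Finset.univ.image s, v ∉ e}) ∪ ↑(S.image fun κ => (s(P κ, P' κ) : Sym2 (Fin n))))).Reachable u z).card ∧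
    (A.filter fun z => ∃ u ∈ RK (Fin.natAdd Mf K),
      (openGraph ((ω' ∩ {e | ∀ v ∈ Finset.univ.image s, v ∉ e}) ∪ ↑(S.image fun κ => (s(P κ, P' κ) : Sym2 (Fin n))))).Reachable u z).card ≤ j}
    with hℓ
  set D₁ : Finset (Fin (Mf + Mc)) → Set (BondConfig (Fin n)) := fun S => {ω' |
    (∀ u ∈ S.image P ∪ S.image P', ¬ (openGraph (ω' ∩ {e | ∀ v ∈ Finset.univ.image s, v ∉ e})).Reachable c u) ∧
      (A.filter fun z => (openGraph (ω' ∩ {e | ∀ v ∈ Finset.univ.image s, v ∉ e})).Reachable c z).card ≤ j} with hD₁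
  set D₂ : Finset (Fin (Mf + Mc)) → Set (BondConfig (Fin n)) := fun S => {ω' |
    (∀ u ∈ S.image P ∪ S.image P', ¬ (openGraph (ω' ∩ {e | ∀ v ∈ Finset.univ.image s, v ∉ e})).Reachable c u) ∧
      1 ≤ (A.filter fun z => ∃ u ∈ S.image P ∪ S.image P',
        (openGraph (ω' ∩ {e | ∀ v ∈ Finset.univ.image s, v ∉ e})).Reachable u z).card ∧
      (A.filter fun z => ∃ u ∈ S.image P ∪ S.image P',
        (openGraph (ω' ∩ {e | ∀ v ∈ Finset.univ.image s, v ∉ e})).Reachable u z).card ≤ j} with hD₂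
  set B : ι → Finset (Fin (Mf + Mc)) → Set (BondConfig (Fin n)) := fun t S => {ω' |
    (∀ u ∈ R t ∪ (S.image P ∪ S.image P'), ¬ (openGraph (ω' ∩ {e | ∀ v ∈ Finset.univ.image s, v ∉ e})).Reachable c u) ∧
      (A.filter fun z => (openGraph (ω' ∩ {e | ∀ v ∈ Finset.univ.image s, v ∉ e})).Reachable c z).card ≤ j} with hB
  set G : Finset (Fin (Mf + Mc)) → Set (BondConfig (Fin n)) := fun S => {ω' |
    (A.filter fun z => (openGraph ((ω' ∩ {e | ∀ v ∈ Finset.univ.image s, v ∉ e}) ∪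
      ↑(S.image fun κ => (s(P κ, P' κ) : Sym2 (Fin n))))).Reachable c z).card ≤ j} with hG
  set SpF : Fin Mf → Finset (Fin (Mf + Mc)) → Set (BondConfig (Fin n)) := fun I S => {ω' |
    (A.filter fun z => (openGraph ((ω' ∩ {e | ∀ v ∈ Finset.univ.image s, v ∉ e}) ∪
      ↑(S.image fun κ => (s(P κ, P' κ) : Sym2 (Fin n))))).Reachable (P (Fin.castAdd Mc I)) z).card ≤ j} with hSpF
  set PS : Finset (Finset (Fin (Mf + Mc))) := (Finset.univ : Finset (Fin (Mf + Mc))).powerset with hPS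
  change C0 * (∑ I, cfF I * ∑ S ∈ PS, W S * (DecisionTree.ind (G S) ω - DecisionTree.ind (SpF I S) ω) +
      ∑ K, D K * ∑ S ∈ PS, W S * (DecisionTree.ind (ρ K S) ω - DecisionTree.ind (ℓ K S) ω)) ≤
    C0 * ∑ S ∈ PS, W S * (DecisionTree.ind (D₁ S) ω - DecisionTree.ind (D₂ S) ω) +
      ∑ t, b t * ∑ S ∈ PS, W S * DecisionTree.ind (B t S) ω
  -- two indicator tools
  have hind_congr : ∀ E F : Set (BondConfig (Fin n)), (ω ∈ E ↔ ω ∈ F) → DecisionTree.ind E ω = DecisionTree.ind F ω := by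
    intro E F h
    by_cases hω : ω ∈ E
    · rw [DecisionTree.ind_of_mem hω, DecisionTree.ind_of_mem (h.1 hω)]
    · rw [DecisionTree.ind_of_not_mem hω, DecisionTree.ind_of_not_mem fun h' => hω (h.2 h')]
  have hind_mono : ∀ E F : Set (BondConfig (Fin n)), (ω ∈ E → ω ∈ F) → DecisionTree.ind E ω ≤ DecisionTree.ind F ω := by
    intro E F h
    by_cases hω : ω ∈ E
    · rw [DecisionTree.ind_of_mem hω, DecisionTree.ind_of_mem (h hω)]
    · rw [DecisionTree.ind_of_not_mem hω]; exact DecisionTree.ind_nonneg _ _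
  -- (0) `D₁ S = G S`
  have hΛ : ∀ S : Finset (Fin (Mf + Mc)), ∀ l ∈ S.image (fun κ => (s(P κ, P' κ) : Sym2 (Fin n))),
      ∃ q q', l = s(q, q') ∧ q ≠ q' ∧ q ∈ A ∧ q' ∈ A ∧ q ≠ c ∧ q' ≠ c := by
    intro S l hl
    obtain ⟨κ, -, rfl⟩ := Finset.mem_image.1 hl
    exact ⟨P κ, P' κ, rfl, hPP' κ, hPA κ, hP'A κ, (hcP κ).1.symm, (hcP κ).2.symm⟩
  have hi : ∀ S, DecisionTree.ind (D₁ S) ω = DecisionTree.ind (G S) ω := by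
    intro S
    have key := sepSmall_links_iff ξ (S.image fun κ => (s(P κ, P' κ) : Sym2 (Fin n))) A ∅ c j hj hcA (hΛ S)
    refine hind_congr _ _ ?_
    simp only [hD₁, hG, mem_setOf_eq]
    constructor
    · rintro ⟨hsep, hsmall⟩
      have h3 := key.1 ⟨fun y hy => absurd hy (Finset.notMem_empty y),
        fun l hl v hv => hsep v ((mem_portPattern_iff P P' S v).2 ⟨l, hl, hv⟩), by convert hsmall using 4⟩
      convert h3.2 using 4
    · intro hsmall
      have h3 := key.2 ⟨fun y hy => absurd hy (Finset.notMem_empty y), by convert hsmall using 4⟩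
      refine ⟨fun u hu => ?_, by convert h3.2.2 using 4⟩
      obtain ⟨l, hl, hul⟩ := (mem_portPattern_iff P P' S u).1 hu
      exact h3.2.1 l hl u hul
  -- (1) the lonely word (`StarSet.mixed_lonely_le`)
  have hlonely : ∀ X : Finset (Fin n), (∀ I : Fin Mf, (P (Fin.castAdd Mc I) ∈ X ∨ P' (Fin.castAdd Mc I) ∈ X) →
      ∃ a ∈ A, a ≠ P (Fin.castAdd Mc I) ∧ a ≠ P' (Fin.castAdd Mc I) ∧
        ((openGraph ξ).Reachable a (P (Fin.castAdd Mc I)) ∨ (openGraph ξ).Reachable a (P' (Fin.castAdd Mc I)))) →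
      ∑ S ∈ PS, W S * DecisionTree.ind (D₂ S) ω ≤
        ∑ I ∈ Finset.univ.filter (fun I => P (Fin.castAdd Mc I) ∉ X), cfF I * ∑ S ∈ PS, W S * DecisionTree.ind (SpF I S) ω +
          ∑ K, D K * ∑ S ∈ PS, W S * DecisionTree.ind (ℓ K S) ω :=
    fun X hX => mixed_lonely_le w A s p p' cls P P' c j hj hPA hP'A hPP' hnopar hforest ω X hX
  -- (2) split the differences
  have hsplitF : ∀ I, ∑ S ∈ PS, W S * (DecisionTree.ind (G S) ω - DecisionTree.ind (SpF I S) ω) =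
      ∑ S ∈ PS, W S * DecisionTree.ind (G S) ω - ∑ S ∈ PS, W S * DecisionTree.ind (SpF I S) ω := fun I => by
    rw [← Finset.sum_sub_distrib]; exact Finset.sum_congr rfl fun S _ => by ring
  have hsplitC : ∀ K, ∑ S ∈ PS, W S * (DecisionTree.ind (ρ K S) ω - DecisionTree.ind (ℓ K S) ω) =
      ∑ S ∈ PS, W S * DecisionTree.ind (ρ K S) ω - ∑ S ∈ PS, W S * DecisionTree.ind (ℓ K S) ω := fun K => by
    rw [← Finset.sum_sub_distrib]; exact Finset.sum_congr rfl fun S _ => by ring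
  have hsplitR : ∑ S ∈ PS, W S * (DecisionTree.ind (D₁ S) ω - DecisionTree.ind (D₂ S) ω) =
      ∑ S ∈ PS, W S * DecisionTree.ind (G S) ω - ∑ S ∈ PS, W S * DecisionTree.ind (D₂ S) ω := by
    rw [← Finset.sum_sub_distrib]; exact Finset.sum_congr rfl fun S _ => by rw [hi S]; ring
  have hF2 : ∑ I, cfF I * ∑ S ∈ PS, W S * (DecisionTree.ind (G S) ω - DecisionTree.ind (SpF I S) ω) =
      (∑ I, cfF I) * ∑ S ∈ PS, W S * DecisionTree.ind (G S) ω - ∑ I, cfF I * ∑ S ∈ PS, W S * DecisionTree.ind (SpF I S) ω := by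
    rw [Finset.sum_mul, ← Finset.sum_sub_distrib]
    exact Finset.sum_congr rfl fun I _ => by rw [hsplitF I]; ring
  have hC2 : ∑ K, D K * ∑ S ∈ PS, W S * (DecisionTree.ind (ρ K S) ω - DecisionTree.ind (ℓ K S) ω) =
      ∑ K, D K * ∑ S ∈ PS, W S * DecisionTree.ind (ρ K S) ω - ∑ K, D K * ∑ S ∈ PS, W S * DecisionTree.ind (ℓ K S) ω := by
    rw [← Finset.sum_sub_distrib]
    exact Finset.sum_congr rfl fun K _ => by rw [hsplitC K]; ring
  rw [hF2, hC2, hsplitR]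
  -- general bounds
  have hρG : ∀ K S, DecisionTree.ind (ρ K S) ω ≤ DecisionTree.ind (G S) ω := fun K S =>
    hind_mono _ _ fun hω => by
      simp only [hρ, mem_setOf_eq] at hω
      simp only [hG, mem_setOf_eq]
      exact hω.2
  have hDRle : ∑ K, D K * ∑ S ∈ PS, W S * DecisionTree.ind (ρ K S) ω ≤ (∑ K, D K) * ∑ S ∈ PS, W S * DecisionTree.ind (G S) ω := by
    rw [Finset.sum_mul]
    refine Finset.sum_le_sum fun K _ => mul_le_mul_of_nonneg_left ?_ (hDnn K)
    exact Finset.sum_le_sum fun S _ => mul_le_mul_of_nonneg_left (hρG K S) (hWnn S)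
  have hBsum_nn : 0 ≤ ∑ t, b t * ∑ S ∈ PS, W S * DecisionTree.ind (B t S) ω :=
    Finset.sum_nonneg fun t _ => mul_nonneg (hb t) (Finset.sum_nonneg fun S _ => mul_nonneg (hWnn S) (DecisionTree.ind_nonneg _ _))
  have hΦnn : 0 ≤ ∑ S ∈ PS, W S * DecisionTree.ind (G S) ω :=
    Finset.sum_nonneg fun S _ => mul_nonneg (hWnn S) (DecisionTree.ind_nonneg _ _)
  have hU0' : C0 * (∑ I, cfF I + ∑ K, D K) ≤ C0 + ∑ t, b t := hU0
  -- the empty dead set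
  have hX0 : ∀ I : Fin Mf, (P (Fin.castAdd Mc I) ∈ (∅ : Finset (Fin n)) ∨ P' (Fin.castAdd Mc I) ∈ (∅ : Finset (Fin n))) →
      ∃ a ∈ A, a ≠ P (Fin.castAdd Mc I) ∧ a ≠ P' (Fin.castAdd Mc I) ∧
        ((openGraph ξ).Reachable a (P (Fin.castAdd Mc I)) ∨ (openGraph ξ).Reachable a (P' (Fin.castAdd Mc I))) :=
    fun I h => h.elim (fun h => absurd h (Finset.notMem_empty _)) fun h => absurd h (Finset.notMem_empty _)
  have hfil0 : Finset.univ.filter (fun I : Fin Mf => P (Fin.castAdd Mc I) ∉ (∅ : Finset (Fin n))) = Finset.univ :=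
    Finset.filter_true_of_mem fun I _ => Finset.notMem_empty _
  have hl0 := hlonely ∅ hX0
  rw [hfil0] at hl0
  have hl0C := mul_le_mul_of_nonneg_left hl0 hC0
  -- (3) trichotomy
  rcases classes_c_trichotomy ξ A P P' c j hj hPA hP'A hPP' hcA hcP with
    hheavy | ⟨hlight, hfar, hsmall⟩ | ⟨r, hr, -, honly, hsmall, hGr, -⟩
  · -- (i) `c` heavy: `G ≡ 0`, `ρ ≡ 0`
    have hG0' : ∀ S, DecisionTree.ind (G S) ω = 0 := fun S =>
      DecisionTree.ind_of_not_mem fun hω => by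
        simp only [hG, mem_setOf_eq] at hω
        have := (hheavy S).trans_le ((card_filter_congr fun _ _ => Iff.rfl).trans_le hω)
        omega
    have hΦ0 : ∑ S ∈ PS, W S * DecisionTree.ind (G S) ω = 0 :=
      Finset.sum_eq_zero fun S _ => by rw [hG0', mul_zero]
    rw [hΦ0] at hDRle ⊢
    have hDRleC := mul_le_mul_of_nonneg_left hDRle hC0
    linarith
  · -- (ii) `c` light and far from every port: `G ≡ 1`, `B ≡ 1`
    have hG1' : ∀ S, DecisionTree.ind (G S) ω = 1 := fun S => DecisionTree.ind_of_mem (by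
      simp only [hG, mem_setOf_eq]; exact (card_filter_congr fun _ _ => Iff.rfl).trans_le (hlight S))
    have hB1 : ∀ t S, DecisionTree.ind (B t S) ω = 1 := by
      intro t S
      refine DecisionTree.ind_of_mem ?_
      simp only [hB, mem_setOf_eq]
      refine ⟨fun u hu => ?_, hsmall⟩
      rcases Finset.mem_union.1 hu with hu | hu
      · obtain ⟨κ, hκ⟩ := hRport t u hu
        rcases hκ with rfl | rfl
        · exact (hfar κ).1
        · exact (hfar κ).2
      · rcases Finset.mem_union.1 hu with hu | hu
        · obtain ⟨κ, -, rfl⟩ := Finset.mem_image.1 hu; exact (hfar κ).1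
        · obtain ⟨κ, -, rfl⟩ := Finset.mem_image.1 hu; exact (hfar κ).2
    have hΦ1 : ∑ S ∈ PS, W S * DecisionTree.ind (G S) ω = 1 := by
      rw [← hsumW]; exact Finset.sum_congr rfl fun S _ => by rw [hG1', mul_one]
    have hBB1 : ∑ t, b t * ∑ S ∈ PS, W S * DecisionTree.ind (B t S) ω = ∑ t, b t := by
      refine Finset.sum_congr rfl fun t _ => ?_
      have : ∑ S ∈ PS, W S * DecisionTree.ind (B t S) ω = 1 := by
        rw [← hsumW]; exact Finset.sum_congr rfl fun S _ => by rw [hB1, mul_one]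
      rw [this, mul_one]
    rw [hΦ1] at hDRle ⊢
    rw [hBB1]
    have hDRleC := mul_le_mul_of_nonneg_left hDRle hC0
    have hSPnn : 0 ≤ ∑ I, cfF I * ∑ S ∈ PS, W S * DecisionTree.ind (SpF I S) ω :=
      Finset.sum_nonneg fun I _ => mul_nonneg (hcfFnn I) (Finset.sum_nonneg fun S _ => mul_nonneg (hWnn S) (DecisionTree.ind_nonneg _ _))
    linarith
  · -- (iii) `c` glued to exactly one port `r`
    have hGiff : ∀ S, ω ∈ G S ↔ ∀ κ ∈ S, P κ ≠ r ∧ P' κ ≠ r := by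
      intro S
      simp only [hG, mem_setOf_eq]
      exact (iff_of_eq (congrArg (· ≤ j) (card_filter_congr fun _ _ => Iff.rfl))).trans (hGr S)
    -- `ρ_K ≡ 0` for chords at `r`
    have hρr : ∀ K, ¬ (P (Fin.natAdd Mf K) ≠ r ∧ P' (Fin.natAdd Mf K) ≠ r) → ∀ S, DecisionTree.ind (ρ K S) ω = 0 := by
      intro K hK S
      refine DecisionTree.ind_of_not_mem fun hω => ?_
      simp only [hρ, hRK, mem_setOf_eq, Finset.image_singleton, Finset.mem_union, Finset.mem_singleton] at hω
      have hr' : ∀ u, u = r → ¬ (openGraph (ξ ∪ L S)).Reachable c u → False :=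
        fun u hu h => h (by rw [hu]; exact reachable_mono_union ξ (L S) hr)
      by_cases h1 : P (Fin.natAdd Mf K) = r
      · exact hr' _ h1 (hω.1 _ (Or.inl rfl))
      · have h2 : P' (Fin.natAdd Mf K) = r := by by_contra h2; exact hK ⟨h1, h2⟩
        exact hr' _ h2 (hω.1 _ (Or.inr rfl))
    -- champion rows of forest classes with `P_I = r` are refunded exactly
    have hSpr : ∀ I, P (Fin.castAdd Mc I) = r → ∀ S, DecisionTree.ind (SpF I S) ω = DecisionTree.ind (G S) ω := by
      intro I hI S
      have hcr : (openGraph (ξ ∪ L S)).Reachable c r := reachable_mono_union ξ (L S) hr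
      refine hind_congr _ _ ?_
      simp only [hSpF, hG, mem_setOf_eq]
      refine iff_of_eq (congrArg (· ≤ j) (card_filter_congr fun z _ => ?_))
      rw [hI]
      exact ⟨fun h => hcr.trans h, fun h => hcr.symm.trans h⟩
    -- budget cells with `r ∉ R_t` dominate `G`
    have hBg : ∀ t, r ∉ R t → ∀ S, DecisionTree.ind (G S) ω ≤ DecisionTree.ind (B t S) ω := by
      intro t ht S
      refine hind_mono _ _ fun hω => ?_
      have hS := (hGiff S).1 hω
      simp only [hB, mem_setOf_eq]
      refine ⟨fun u hu hcu => ?_, hsmall⟩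
      have huA : u ∈ A ∧ u ≠ c ∧ u ≠ r := by
        rcases Finset.mem_union.1 hu with hu | hu
        · obtain ⟨κ, hκ⟩ := hRport t u hu
          have hur : u ≠ r := fun h => ht (h ▸ hu)
          rcases hκ with rfl | rfl
          · exact ⟨hPA κ, (hcP κ).1.symm, hur⟩
          · exact ⟨hP'A κ, (hcP κ).2.symm, hur⟩
        · rcases Finset.mem_union.1 hu with hu | hu
          · obtain ⟨κ, hκ, rfl⟩ := Finset.mem_image.1 hu; exact ⟨hPA κ, (hcP κ).1.symm, (hS κ hκ).1⟩
          · obtain ⟨κ, hκ, rfl⟩ := Finset.mem_image.1 hu; exact ⟨hP'A κ, (hcP κ).2.symm, (hS κ hκ).2⟩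
      exact (honly u huA.1 hcu).elim huA.2.1 huA.2.2
    -- the lonely word with dead port `r` (witness `c`)
    have hXr : ∀ I : Fin Mf, (P (Fin.castAdd Mc I) ∈ ({r} : Finset (Fin n)) ∨ P' (Fin.castAdd Mc I) ∈ ({r} : Finset (Fin n))) →
        ∃ a ∈ A, a ≠ P (Fin.castAdd Mc I) ∧ a ≠ P' (Fin.castAdd Mc I) ∧
          ((openGraph ξ).Reachable a (P (Fin.castAdd Mc I)) ∨ (openGraph ξ).Reachable a (P' (Fin.castAdd Mc I))) := by
      intro I hI
      refine ⟨c, hcA, (hcP _).1, (hcP _).2, ?_⟩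
      simp only [Finset.mem_singleton] at hI
      exact hI.elim (fun h => Or.inl (by rw [h]; exact hr)) fun h => Or.inr (by rw [h]; exact hr)
    have hfilr : Finset.univ.filter (fun I : Fin Mf => P (Fin.castAdd Mc I) ∉ ({r} : Finset (Fin n))) =
        Finset.univ.filter (fun I : Fin Mf => P (Fin.castAdd Mc I) ≠ r) :=
      Finset.filter_congr fun I _ => by rw [Finset.mem_singleton]
    have hlr := hlonely {r} hXr
    rw [hfilr] at hlr
    have hlrC := mul_le_mul_of_nonneg_left hlr hC0
    -- bookkeeping
    have hcfsplit : ∑ I, cfF I = ∑ I ∈ Finset.univ.filter (fun I => P (Fin.castAdd Mc I) ≠ r), cfF I +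
        ∑ I ∈ Finset.univ.filter (fun I => ¬ (P (Fin.castAdd Mc I) ≠ r)), cfF I :=
      (Finset.sum_filter_add_sum_filter_not _ _ _).symm
    have hspsplit : ∑ I, cfF I * ∑ S ∈ PS, W S * DecisionTree.ind (SpF I S) ω =
        ∑ I ∈ Finset.univ.filter (fun I => P (Fin.castAdd Mc I) ≠ r), cfF I * ∑ S ∈ PS, W S * DecisionTree.ind (SpF I S) ω +
          (∑ I ∈ Finset.univ.filter (fun I => ¬ (P (Fin.castAdd Mc I) ≠ r)), cfF I) * ∑ S ∈ PS, W S * DecisionTree.ind (G S) ω := by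
      rw [← Finset.sum_filter_add_sum_filter_not Finset.univ (fun I => P (Fin.castAdd Mc I) ≠ r)
        (fun I => cfF I * ∑ S ∈ PS, W S * DecisionTree.ind (SpF I S) ω), Finset.sum_mul]
      congr 1
      refine Finset.sum_congr rfl fun I hI => ?_
      have hIr : P (Fin.castAdd Mc I) = r := not_not.1 (Finset.mem_filter.1 hI).2
      exact congrArg (cfF I * ·) (Finset.sum_congr rfl fun S _ => by rw [hSpr I hIr S])
    have hrhsplit : ∑ K, D K * ∑ S ∈ PS, W S * DecisionTree.ind (ρ K S) ω ≤
        (∑ K ∈ Finset.univ.filter (fun K => P (Fin.natAdd Mf K) ≠ r ∧ P' (Fin.natAdd Mf K) ≠ r), D K) *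
          ∑ S ∈ PS, W S * DecisionTree.ind (G S) ω := by
      rw [Finset.sum_mul, ← Finset.sum_filter_add_sum_filter_not Finset.univ (fun K => P (Fin.natAdd Mf K) ≠ r ∧ P' (Fin.natAdd Mf K) ≠ r)
        (fun K => D K * ∑ S ∈ PS, W S * DecisionTree.ind (ρ K S) ω)]
      have hzero : ∑ K ∈ Finset.univ.filter (fun K => ¬ (P (Fin.natAdd Mf K) ≠ r ∧ P' (Fin.natAdd Mf K) ≠ r)),
          D K * ∑ S ∈ PS, W S * DecisionTree.ind (ρ K S) ω = 0 :=
        Finset.sum_eq_zero fun K hK => by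
          simp only [hρr K (Finset.mem_filter.1 hK).2, mul_zero, Finset.sum_const_zero]
      rw [hzero, add_zero]
      refine Finset.sum_le_sum fun K _ => mul_le_mul_of_nonneg_left ?_ (hDnn K)
      exact Finset.sum_le_sum fun S _ => mul_le_mul_of_nonneg_left (hρG K S) (hWnn S)
    have hbud : (∑ t ∈ Finset.univ.filter (fun t => r ∉ R t), b t) * ∑ S ∈ PS, W S * DecisionTree.ind (G S) ω ≤
        ∑ t, b t * ∑ S ∈ PS, W S * DecisionTree.ind (B t S) ω := by
      rw [← Finset.sum_filter_add_sum_filter_not Finset.univ (fun t => r ∉ R t) (fun t => b t * _)]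
      have hnn : 0 ≤ ∑ t ∈ Finset.univ.filter (fun t => ¬ (r ∉ R t)), b t * ∑ S ∈ PS, W S * DecisionTree.ind (B t S) ω :=
        Finset.sum_nonneg fun t _ => mul_nonneg (hb t) (Finset.sum_nonneg fun S _ => mul_nonneg (hWnn S) (DecisionTree.ind_nonneg _ _))
      rw [Finset.sum_mul]
      refine le_trans ?_ (le_add_of_nonneg_right hnn)
      refine Finset.sum_le_sum fun t ht => mul_le_mul_of_nonneg_left ?_ (hb t)
      exact Finset.sum_le_sum fun S _ => mul_le_mul_of_nonneg_left (hBg t (Finset.mem_filter.1 ht).2 S) (hWnn S)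
    have hU1r : C0 * (∑ I ∈ Finset.univ.filter (fun I => P (Fin.castAdd Mc I) ≠ r), cfF I +
        ∑ K ∈ Finset.univ.filter (fun K => P (Fin.natAdd Mf K) ≠ r ∧ P' (Fin.natAdd Mf K) ≠ r), D K) ≤
        C0 + ∑ t ∈ Finset.univ.filter (fun t => r ∉ R t), b t := hU1 r
    have hU1rΦ := mul_le_mul_of_nonneg_right hU1r hΦnn
    have hrhC := mul_le_mul_of_nonneg_left hrhsplit hC0
    rw [hspsplit, hcfsplit]
    nlinarith [hlrC, hU1rΦ, hrhC, hbud, hΦnn, hC0]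

end StarSet

end Summit.CriticalPhenomena.PercolationContinuityZ3.Theorems

end
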